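import Literature.Probability.LatticeModels.ScaleFrameDatumDecomp
import HarnessLib

/-!
# The probability of an inner exploration datum is comparable across environments (proved)

Topic `Literature/Probability/LatticeModels` (trunk `StatMech`, family `crit-ising`). In Kesten's
ratio-limit scheme (H. Kesten, *The incipient infinite cluster in two-dimensional percolation*, PTRF 73
(1986), §2, proof of Lemma (23)) run with the exploration-from-inside data of D. Basu, A. Sapozhnikov
(ECP 22 (2017), §2) on a `ScaleFrame`, the probability of an inner datum event
`F(d') = {𝒞 = U', 𝒟 = R'} ∩ {rim wired through U'}` must not depend, up to the RSW constant `c`, on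
the environment far outside: for every edge set `Eenv` between the local edges below scale `aM^{m+4}`
and the frame, and every wired set `Benv` whose good vertices lie above that scale,
`c · φ^∅_loc(F(d')) ≤ φ^{Benv}_{⟨Eenv⟩}(F(d'))` and `c · φ^{Benv}_{⟨Eenv⟩}(F(d')) ≤ φ^∅_loc(F(d'))`
(`ScaleFrame.datum_prob_comparable`, registered short name `datum_prob_comparable`).

Proof (tools in `ScaleFrameDatumDecomp.lean`). (0) On lattice configurations `F(d') = D ∩ I`, `D` the
decreasing cylinder "the frame edges `Sc` from `U'` to vertices off `U' ∪ R'` are closed", `I`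
increasing and read on the edges `T` from `U'` into `U' ∪ R'`; both live inside the core
`{good, rad ≤ aM^{m+2}}`. (1) Closed-outside domain Markov: `φ(D ∩ I) = φ(D) · φ_{∖Sc}(I)` for both
measures. (2) `c · loc(D) ≤ φ^L_loc(D) ≤ env(D) ≤ φ^{Benv}_loc(D) ≤ loc(D)` and (3)
`loc'(I) ≤ φ^{Benv}_{loc'}(I) ≤ env'(I) ≤ φ^L_{loc'}(I) ≤ c⁻¹ loc'(I)`, where `L ⊇ Benv` wires every
vertex above scale `aM^{m+4} - η` or off `good` (it contains the endpoints of all environment edges off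
the local ones, by frame continuity): the middle inequalities are the conditional-domination sandwich,
the outer ones the comparison of boundary conditions and the monotone boundary-pushing toolkit (B'),
(A) of `RandomClusterBoundaryPushing.lean` across the collar `(aM^{m+2}, aM^{m+3})`, fed by the
frame's `NoCrossBound`. (4) Multiply. Everything is proved; no definitions.

## References
* [Kesten1986] H. Kesten, Probab. Theory Related Fields 73 (1986) 369–394, §2, proof of Lemma (23).
* [BasuSapozhnikov2017ECP] D. Basu, A. Sapozhnikov, ECP 22 (2017) no. 26, §2.
* G. Grimmett, *The Random-Cluster Model*, Springer (2006): Thm. (3.1)(a), Lemma (4.13), (4.14).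
-/

noncomputable section

open MeasureTheory Finset SimpleGraph
open Literature.Probability.Percolation (BondConfig openConnIn explSet explRim explEvent
  mem_explEvent_iff subset_explSet mem_of_mem_explEvent_of_open_edge explRim_disjoint)

namespace Literature.Probability.LatticeModels

/-- **(K1) The probability of an inner datum is comparable across environments** (Kesten 1986, proof
of Lemma (23), for the random-cluster measure with the exploration data of Basu–Sapozhnikov 2017, §2).
For a scale frame with `M ≥ 2`, `m ≥ 1`, `aM^{m+4} ≤ Rmax`, `η ≤ a` and the no-radial-crossing bound
(RSW (ii)) for the annulus `(aM^{m+2}, aM^{m+3})`: for inner data `U' ⊆ {good, rad < aM^m}`,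
`R' ⊆ {good, rad < aM^m + η}`, the saturated datum event `Fd = {𝒞 = U', 𝒟 = R'} ∩ {rim wired through
U'}` (read on `ω ∩ E`) satisfies `c · loc(Fd) ≤ env(Fd)` and `c · env(Fd) ≤ loc(Fd)`, where `loc` is
the free measure of the edges below scale `aM^{m+4}` and `env` the measure of ANY edge set between those
and `E`, wired on ANY set whose good vertices lie above scale `aM^{m+4}`.
[cite: Kesten1986, proof of Lemma (23)] -/
theorem ScaleFrame.datum_prob_comparable :
    ∀ {V : Type*} [Fintype V] [DecidableEq V] (F : ScaleFrame V) {p q c a M : ℝ} {m : ℕ},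
      p ∈ Set.Ico (0 : ℝ) 1 → 1 ≤ q → 0 < c → 0 < a → 2 ≤ M → 1 ≤ m →
      a * M ^ (m + 4) ≤ F.Rmax → F.η ≤ a →
      F.NoCrossBound p q c (a * M ^ (m + 2)) (a * M ^ (m + 3)) →
    ∀ (U' R' : Set V),
      (∀ v ∈ U', v ∈ F.good ∧ F.rad v < a * M ^ m) →
      (∀ v ∈ R', v ∈ F.good ∧ F.rad v < a * M ^ m + F.η) →
    ∀ (Eenv : Finset (Sym2 V)) (Benv : Set V),
      F.edgesWithin (F.good ∩ {v | F.rad v < a * M ^ (m + 4)}) ⊆ Eenv → Eenv ⊆ F.E →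
      (∀ v ∈ Benv, v ∈ F.good → a * M ^ (m + 4) ≤ F.rad v) →
      let Fd : Set (BondConfig V) := {ω | ω ∩ (↑F.E : Set (Sym2 V)) ∈
        explEvent (F.inSet a) (F.annSet a (a * M ^ m)) U' R' ∩
          {ω | ∀ r ∈ R', ∀ r₂ ∈ R', ∃ v ∈ U', ∃ v' ∈ U',
            s(v, r) ∈ ω ∧ s(v', r₂) ∈ ω ∧ ω ∈ openConnIn U' v v'}}
      let loc := rcMeasure (fromEdgeSet
        (↑(F.edgesWithin (F.good ∩ {v | F.rad v < a * M ^ (m + 4)})) : Set (Sym2 V))) p q ∅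
      let env := rcMeasure (fromEdgeSet (↑Eenv : Set (Sym2 V))) p q Benv
      c * loc.real Fd ≤ env.real Fd ∧ c * env.real Fd ≤ loc.real Fd := by
  intro V _ _ F p q c a M m hp hq hc ha hM hm hRmax hηa hNC U' R' hU' hR' Eenv Benv hEenv hEenvE hBenv
    Fd loc env
  classical
  have hp' : p ∈ Set.Icc (0 : ℝ) 1 := ⟨hp.1, hp.2.le⟩
  have hq0 : 0 < q := one_pos.trans_le hq
  have hη0 := F.η_pos
  -- the scales
  have hsc0 : a ≤ a * M ^ m := le_mul_of_one_le_right ha.le (one_le_pow₀ (by linarith))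
  have hsc1 : a * M ^ m + a ≤ a * M ^ (m + 1) := scale_step ha.le hM m
  have hsc2 : a * M ^ (m + 1) + a ≤ a * M ^ (m + 2) := scale_step ha.le hM (m + 1)
  have hsc3 : a * M ^ (m + 2) + a ≤ a * M ^ (m + 3) := scale_step ha.le hM (m + 2)
  have hsc4 : a * M ^ (m + 3) + a ≤ a * M ^ (m + 4) := scale_step ha.le hM (m + 3)
  have hN2 : a * M ^ (m + 2) + F.η ≤ a * M ^ (m + 3) := by linarith
  have hs'R : a * M ^ (m + 3) ≤ F.Rmax := by linarith
  -- the objects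
  set In : Set V := F.inSet a with hIn_def
  set Blk : Set V := F.annSet a (a * M ^ m) with hBlk_def
  set Core : Set V := F.inSet (a * M ^ (m + 2)) with hCore_def
  set Ann : Set V := F.annSet (a * M ^ (m + 2)) (a * M ^ (m + 3)) with hAnn_def
  set E₄ : Finset (Sym2 V) := F.edgesWithin (F.good ∩ {v | F.rad v < a * M ^ (m + 4)}) with hE₄_def
  set L : Set V := Benv ∪ {v | v ∈ F.good → a * M ^ (m + 4) - F.η ≤ F.rad v} with hL_def
  set Sc : Finset (Sym2 V) := F.E.filter (fun e => ∃ v ∈ e, ∃ w ∈ e, v ∈ U' ∧ w ∉ U' ∪ R')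
    with hSc_def
  set T : Finset (Sym2 V) :=
    F.E.filter (fun e => ¬ e.IsDiag ∧ (∃ v ∈ e, v ∈ U') ∧ ∀ x ∈ e, x ∈ U' ∪ R') with hT_def
  set R₂ : Finset (Sym2 V) := E₄.filter (fun e => ¬ e.IsDiag) with hR₂_def
  set EL : Finset (Sym2 V) := R₂ \ Sc with hEL_def
  set EE : Finset (Sym2 V) := (Eenv.filter fun e => ¬ e.IsDiag) \ Sc with hEE_def
  set EA : Finset (Sym2 V) := (F.edgesTouching Ann).filter (fun e => ¬ e.IsDiag) with hEA_def
  set D : Set (BondConfig V) := {ω | ∀ e ∈ Sc, e ∉ ω} with hD_def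
  set P : Set (Sym2 V) → Prop := fun X => (∀ v ∈ U', ∃ u ∈ In, X ∈ openConnIn U' u v) ∧
      ∀ r ∈ R', ∀ r₂ ∈ R', ∃ v ∈ U', ∃ v' ∈ U', s(v, r) ∈ X ∧ s(v', r₂) ∈ X ∧ X ∈ openConnIn U' v v'
    with hP_def
  set I : Set (BondConfig V) := {ω | P (ω ∩ ↑T)} with hI_def
  -- degenerate data: the datum event is empty
  by_cases hdeg : In ⊆ U' ∧ ∀ r ∈ R', r ∉ In ∪ Blk
  swap
  · have h0 : Fd = ∅ := by
      refine Set.eq_empty_of_forall_notMem fun ω hω => hdeg ?_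
      have hev : ω ∩ (↑F.E : Set (Sym2 V)) ∈ explEvent In Blk U' R' := hω.1
      obtain ⟨hE, hRim⟩ := mem_explEvent_iff.1 hev
      refine ⟨hE ▸ subset_explSet In Blk _, fun r hr => ?_⟩
      rw [← hRim] at hr
      exact explRim_disjoint hr
    rw [h0]
    simp only [measureReal_empty, mul_zero, le_refl, and_self]
  -- the vertices of `U' ∪ R'` and their neighbours
  have hUR : ∀ x ∈ U' ∪ R', x ∈ F.good ∧ F.rad x < a * M ^ m + F.η := by
    rintro x (hx | hx)
    · exact ⟨(hU' x hx).1, by linarith [(hU' x hx).2]⟩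
    · exact hR' x hx
  have hnear : ∀ e ∈ F.E, ∀ v ∈ e, v ∈ U' → ∀ x ∈ e, x ∈ F.good ∧ F.rad x < a * M ^ m + F.η := by
    intro e he v hv hvU x hx
    obtain ⟨hvg, hvr⟩ := hU' v hvU
    obtain ⟨hxg, hxr⟩ := F.adj_good e he v hv x hx hvg (by linarith)
    exact ⟨hxg, by linarith [(abs_lt.1 hxr).2]⟩
  have hUIB : U' ⊆ In ∪ Blk := fun v hv => by
    obtain ⟨hg, hr⟩ := hU' v hv
    by_cases h : F.rad v ≤ a
    · exact Or.inl ⟨hg, h⟩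
    · exact Or.inr ⟨hg, not_le.1 h, hr⟩
  -- the edge sets
  have hSc_mem : ∀ e, e ∈ Sc ↔ e ∈ F.E ∧ ∃ v ∈ e, ∃ w ∈ e, v ∈ U' ∧ w ∉ U' ∪ R' := fun e => by
    rw [hSc_def, Finset.mem_filter]
  have hT_mem : ∀ e, e ∈ T ↔ e ∈ F.E ∧ ¬ e.IsDiag ∧ (∃ v ∈ e, v ∈ U') ∧ ∀ x ∈ e, x ∈ U' ∪ R' :=
    fun e => by rw [hT_def, Finset.mem_filter]
  have hE₄_mem : ∀ e, e ∈ E₄ ↔ e ∈ F.E ∧ ∀ x ∈ e, x ∈ F.good ∧ F.rad x < a * M ^ (m + 4) :=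
    fun e => by simp only [hE₄_def, F.mem_edgesWithin, Set.mem_inter_iff, Set.mem_setOf_eq]
  have hR₂_mem : ∀ e, e ∈ R₂ ↔ e ∈ E₄ ∧ ¬ e.IsDiag := fun e => by rw [hR₂_def, Finset.mem_filter]
  have hEL_mem : ∀ e, e ∈ EL ↔ (e ∈ E₄ ∧ ¬ e.IsDiag) ∧ e ∉ Sc := fun e => by
    rw [hEL_def, Finset.mem_sdiff, hR₂_mem]
  have hEE_mem : ∀ e, e ∈ EE ↔ (e ∈ Eenv ∧ ¬ e.IsDiag) ∧ e ∉ Sc := fun e => by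
    rw [hEE_def, Finset.mem_sdiff, Finset.mem_filter]
  have hEA_mem : ∀ e, e ∈ EA ↔ (e ∈ F.E ∧ ∃ v ∈ e, v ∈ Ann) ∧ ¬ e.IsDiag := fun e => by
    rw [hEA_def, Finset.mem_filter, F.mem_edgesTouching]
  have hE₄F : E₄ ⊆ F.E := fun e he => ((hE₄_mem e).1 he).1
  have hScE₄ : Sc ⊆ E₄ := fun e he => by
    obtain ⟨heE, v, hv, w, -, hvU, -⟩ := (hSc_mem e).1 he
    refine (hE₄_mem e).2 ⟨heE, fun x hx => ?_⟩
    obtain ⟨hxg, hxr⟩ := hnear e heE v hv hvU x hx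
    exact ⟨hxg, by linarith⟩
  have hScR₂ : Sc ⊆ R₂ := fun e he => by
    obtain ⟨-, v, hv, w, hw, hvU, hwUR⟩ := (hSc_mem e).1 he
    have hne : v ≠ w := fun h => hwUR (Or.inl (h ▸ hvU))
    refine (hR₂_mem e).2 ⟨hScE₄ he, ?_⟩
    rw [(Sym2.mem_and_mem_iff hne).1 ⟨hv, hw⟩, Sym2.mk_isDiag_iff]
    exact hne
  have hScCore : ∀ e ∈ Sc, ∀ x ∈ e, x ∈ Core := fun e he x hx => by
    obtain ⟨heE, v, hv, w, -, hvU, -⟩ := (hSc_mem e).1 he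
    obtain ⟨hxg, hxr⟩ := hnear e heE v hv hvU x hx
    exact ⟨hxg, by linarith⟩
  have hScAnn : ∀ e ∈ Sc, ∀ x ∈ e, x ∉ Ann := fun e he x hx hxA => by
    obtain ⟨heE, v, hv, w, -, hvU, -⟩ := (hSc_mem e).1 he
    obtain ⟨-, hxr⟩ := hnear e heE v hv hvU x hx
    obtain ⟨-, hxA, -⟩ := hxA
    linarith
  have hTE₄ : T ⊆ E₄ := fun e he => by
    obtain ⟨heE, -, -, hall⟩ := (hT_mem e).1 he
    refine (hE₄_mem e).2 ⟨heE, fun x hx => ?_⟩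
    obtain ⟨hxg, hxr⟩ := hUR x (hall x hx)
    exact ⟨hxg, by linarith⟩
  have hTSc : ∀ e ∈ T, e ∉ Sc := fun e he heS => by
    obtain ⟨-, -, -, hall⟩ := (hT_mem e).1 he
    obtain ⟨-, v, -, w, hw, -, hwUR⟩ := (hSc_mem e).1 heS
    exact hwUR (hall w hw)
  have hTEL : T ⊆ EL := fun e he => (hEL_mem e).2 ⟨⟨hTE₄ he, ((hT_mem e).1 he).2.1⟩, hTSc e he⟩
  have hTEE : T ⊆ EE := fun e he =>
    (hEE_mem e).2 ⟨⟨hEenv (hTE₄ he), ((hT_mem e).1 he).2.1⟩, hTSc e he⟩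
  have hTCore : ∀ e ∈ T, ∀ x ∈ e, x ∈ Core := fun e he x hx => by
    obtain ⟨-, -, -, hall⟩ := (hT_mem e).1 he
    obtain ⟨hxg, hxr⟩ := hUR x (hall x hx)
    exact ⟨hxg, by linarith⟩
  have hELF : EL ⊆ F.E := fun e he => hE₄F ((hEL_mem e).1 he).1.1
  have hR₂F : R₂ ⊆ F.E := fun e he => hE₄F ((hR₂_mem e).1 he).1
  -- the collar hypotheses of the boundary-pushing toolkit
  have hCA : ∀ v ∈ Core, v ∉ Ann := fun v hv hvA =>
    Set.disjoint_left.1 (F.inSet_disjoint_annSet _ _) hv hvA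
  have hCoreE : ∀ E' : Finset (Sym2 V), E' ⊆ F.E → ∀ e ∈ E', (∃ v ∈ Core, v ∈ e) →
      ∀ x ∈ e, x ∈ Core ∨ x ∈ Ann := fun E' hE' e he ⟨v, hv, hve⟩ x hx =>
    F.mem_inSet_or_annSet_of_adj hN2 hs'R (hE' he) hve hx hv
  have hW : ∀ w ∈ L, w ∉ Core ∧ w ∉ Ann := by
    intro w hw
    rw [hL_def, Set.mem_union, Set.mem_setOf_eq] at hw
    have hfar : w ∈ F.good → a * M ^ (m + 3) ≤ F.rad w := fun hwg => by
      rcases hw with hwB | hwL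
      · have := hBenv w hwB hwg; linarith
      · have := hwL hwg; linarith
    refine ⟨fun ⟨hwg, hwr⟩ => ?_, fun ⟨hwg, _, hwr⟩ => ?_⟩
    · have := hfar hwg; linarith
    · have := hfar hwg; linarith
  have hAnnE₄ : ∀ e ∈ F.E, (∃ v ∈ e, v ∈ Ann) → e ∈ E₄ := fun e he ⟨v, hv, hvA⟩ =>
    (hE₄_mem e).2 ⟨he, fun x hx => by
      obtain ⟨hvg, -, hvr⟩ := hvA
      obtain ⟨hxg, hxr⟩ := F.adj_good e he v hv x hx hvg (by linarith)
      exact ⟨hxg, by linarith [(abs_lt.1 hxr).2]⟩⟩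
  have hEA_R₂ : ∀ e, e ∈ EA ↔ e ∈ R₂ ∧ ∃ v ∈ Ann, v ∈ e := fun e => by
    rw [hEA_mem, hR₂_mem]
    constructor
    · rintro ⟨⟨heE, v, hv, hvA⟩, hnd⟩
      exact ⟨⟨hAnnE₄ e heE ⟨v, hv, hvA⟩, hnd⟩, v, hvA, hv⟩
    · rintro ⟨⟨heE₄, hnd⟩, v, hvA, hv⟩
      exact ⟨⟨hE₄F heE₄, v, hv, hvA⟩, hnd⟩
  have hEA_EL : ∀ e, e ∈ EA ↔ e ∈ EL ∧ ∃ v ∈ Ann, v ∈ e := fun e => by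
    rw [hEA_R₂, hEL_mem, hR₂_mem]
    constructor
    · rintro ⟨h, v, hvA, hv⟩
      exact ⟨⟨h, fun heS => hScAnn e heS v hv hvA⟩, v, hvA, hv⟩
    · rintro ⟨⟨h, -⟩, hv⟩
      exact ⟨h, hv⟩
  -- (0) the datum event on lattice configurations: closed cylinder `D` and increasing part `P`
  have hdec : ∀ ω : BondConfig V, (∀ e ∈ ω, e ∈ F.E ∧ ¬ e.IsDiag) →
      (ω ∈ Fd ↔ (∀ e ∈ Sc, e ∉ ω) ∧ P (ω ∩ ↑T)) := by
    intro ω hω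
    have hωE : ω ∩ (↑F.E : Set (Sym2 V)) = ω :=
      Set.inter_eq_left.2 fun e he => Finset.mem_coe.2 (hω e he).1
    show ω ∩ (↑F.E : Set (Sym2 V)) ∈ explEvent In Blk U' R' ∩ _ ↔ _
    rw [hωE, Set.mem_inter_iff, Set.mem_setOf_eq]
    constructor
    · rintro ⟨hev, hwired⟩
      refine ⟨fun e heS heω => ?_,
        mem_explEvent_rimWired_forward (fun v hv w hw hne h => ?_) hev hwired⟩
      · obtain ⟨-, v, hv, w, hw, hvU, hwUR⟩ := (hSc_mem e).1 heS
        have hne : v ≠ w := fun h => hwUR (Or.inl (h ▸ hvU))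
        rw [(Sym2.mem_and_mem_iff hne).1 ⟨hv, hw⟩] at heω
        exact hwUR (Or.inr
          (mem_of_mem_explEvent_of_open_edge hev hvU heω fun h => hwUR (Or.inl h)))
      · refine Finset.mem_coe.2 ((hT_mem _).2
          ⟨(hω _ h).1, (hω _ h).2, ⟨v, Sym2.mem_mk_left v w, hv⟩, fun x hx => ?_⟩)
        rcases Sym2.mem_iff.1 hx with rfl | rfl
        · exact Or.inl hv
        · exact hw
    · rintro ⟨hDω, hIω⟩
      exact mem_explEvent_rimWired_backward hdeg.1 hUIB hdeg.2
        (fun v hv w hw h => Finset.mem_coe.2 ((hSc_mem _).2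
          ⟨(hω _ h).1, v, Sym2.mem_mk_left v w, w, Sym2.mem_mk_right v w, hv, hw⟩))
        (fun e he => hDω e (Finset.mem_coe.1 he)) hIω.1 hIω.2
  have hAE : ∀ E' : Finset (Sym2 V), E' ⊆ F.E → ∀ ω : BondConfig V,
      ω ⊆ (fromEdgeSet (E' : Set (Sym2 V))).edgeSet →
        (ω ∈ Fd ↔ (∀ e ∈ Sc, e ∉ ω) ∧ P (ω ∩ ↑T)) :=
    fun E' hE' ω hω => hdec ω fun e he => by
      have h := hω he
      rw [edgeSet_fromEdgeSet, Set.mem_sdiff, Finset.mem_coe, Sym2.mem_diagSet] at h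
      exact ⟨hE' h.1, h.2⟩
  -- monotonicity and locality of `D` and `I`
  have hPmono : ∀ X Y : Set (Sym2 V), X ⊆ Y → P X → P Y := by
    rintro X Y hXY ⟨h1, h2⟩
    have hconn : ∀ a b : V, X ∈ openConnIn U' a b → Y ∈ openConnIn U' a b := fun a b h =>
      openConnIn_of_agree_ne h fun x _ y _ _ hxy => hXY hxy
    refine ⟨fun v hv => ?_, fun r hr r₂ hr₂ => ?_⟩
    · obtain ⟨u, hu, huv⟩ := h1 v hv
      exact ⟨u, hu, hconn u v huv⟩
    · obtain ⟨v, hv, v', hv', hvr, hv'r, hvv'⟩ := h2 r hr r₂ hr₂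
      exact ⟨v, hv, v', hv', hXY hvr, hXY hv'r, hconn v v' hvv'⟩
  have hI : IsUpperSet I := fun ω₁ ω₂ hle h =>
    hPmono _ _ (Set.inter_subset_inter_left _ hle) h
  have hD : IsLowerSet D := fun ω₁ ω₂ hle h e he heω => h e he (hle heω)
  have hDdet : ∀ ω₁ ω₂ : BondConfig V, (∀ e ∈ R₂, (∀ x ∈ e, x ∈ Core) → (e ∈ ω₁ ↔ e ∈ ω₂)) →
      (ω₁ ∈ D ↔ ω₂ ∈ D) := fun ω₁ ω₂ h =>
    forall₂_congr fun e he => not_congr (h e (hScR₂ he) (hScCore e he))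
  have hIdet : ∀ ω₁ ω₂ : BondConfig V, (∀ e ∈ EL, (∀ x ∈ e, x ∈ Core) → (e ∈ ω₁ ↔ e ∈ ω₂)) →
      (ω₁ ∈ I ↔ ω₂ ∈ I) := fun ω₁ ω₂ h => by
    have hTeq : ω₁ ∩ (↑T : Set (Sym2 V)) = ω₂ ∩ ↑T := Set.ext fun e => by
      refine ⟨fun he => ⟨?_, he.2⟩, fun he => ⟨?_, he.2⟩⟩
      · exact (h e (hTEL (Finset.mem_coe.1 he.2)) (hTCore e (Finset.mem_coe.1 he.2))).1 he.1
      · exact (h e (hTEL (Finset.mem_coe.1 he.2)) (hTCore e (Finset.mem_coe.1 he.2))).2 he.1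
    show P (ω₁ ∩ ↑T) ↔ P (ω₂ ∩ ↑T)
    rw [hTeq]
  have hDR₂ : {ω : BondConfig V | ω ∩ ↑R₂ ∈ D} = D := Set.ext fun ω =>
    forall₂_congr fun e he => not_congr ⟨fun h' => h'.1, fun h' => ⟨h', Finset.mem_coe.2 (hScR₂ he)⟩⟩
  have hIEL : {ω : BondConfig V | ω ∩ ↑EL ∈ I} = I := Set.ext fun ω => by
    show P (ω ∩ ↑EL ∩ ↑T) ↔ P (ω ∩ ↑T)
    rw [Set.inter_assoc, Set.inter_eq_right.2 (Finset.coe_subset.2 hTEL)]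
  -- the regions inside the environment graphs, and the frozen edges off them
  have hR₂env : ∀ i : Fintype (fromEdgeSet (Eenv : Set (Sym2 V))).edgeSet,
      R₂ ⊆ @edgeFinset V (fromEdgeSet (Eenv : Set (Sym2 V))) i := fun i e he =>
    (mem_edgeFinset_fromEdgeSet_iff Eenv i e).2 ⟨hEenv ((hR₂_mem e).1 he).1, ((hR₂_mem e).1 he).2⟩
  have hELEE : ∀ i : Fintype (fromEdgeSet (EE : Set (Sym2 V))).edgeSet,
      EL ⊆ @edgeFinset V (fromEdgeSet (EE : Set (Sym2 V))) i := fun i e he => by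
    obtain ⟨⟨heE₄, hnd⟩, heS⟩ := (hEL_mem e).1 he
    exact (mem_edgeFinset_fromEdgeSet_iff EE i e).2 ⟨(hEE_mem e).2 ⟨⟨hEenv heE₄, hnd⟩, heS⟩, hnd⟩
  have hLfar : ∀ e ∈ F.E, ¬ e.IsDiag → e ∉ R₂ → ∀ x ∈ e, x ∈ L := fun e he hnd heR x hx =>
    Or.inr fun hxg => F.le_rad_of_not_mem_edgesWithin hRmax he
      (fun heE₄ => heR ((hR₂_mem e).2 ⟨heE₄, hnd⟩)) hx hxg
  have hoffenv : ∀ i : Fintype (fromEdgeSet (Eenv : Set (Sym2 V))).edgeSet,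
      ∀ e ∈ @edgeFinset V (fromEdgeSet (Eenv : Set (Sym2 V))) i \ R₂, ∀ x ∈ e, x ∈ L :=
    fun i e he x hx => by
      obtain ⟨heG, heR⟩ := Finset.mem_sdiff.1 he
      obtain ⟨heE, hnd⟩ := (mem_edgeFinset_fromEdgeSet_iff Eenv i e).1 heG
      exact hLfar e (hEenvE heE) hnd heR x hx
  have hoffEE : ∀ i : Fintype (fromEdgeSet (EE : Set (Sym2 V))).edgeSet,
      ∀ e ∈ @edgeFinset V (fromEdgeSet (EE : Set (Sym2 V))) i \ EL, ∀ x ∈ e, x ∈ L :=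
    fun i e he x hx => by
      obtain ⟨heG, heL⟩ := Finset.mem_sdiff.1 he
      obtain ⟨heE, hnd⟩ := (mem_edgeFinset_fromEdgeSet_iff EE i e).1 heG
      obtain ⟨⟨heEnv, -⟩, heS⟩ := (hEE_mem e).1 heE
      exact hLfar e (hEenvE heEnv) hnd (fun heR => heL ((hEL_mem e).2 ⟨(hR₂_mem e).1 heR, heS⟩))
        x hx
  have hGR : fromEdgeSet (R₂ : Set (Sym2 V)) = fromEdgeSet (E₄ : Set (Sym2 V)) := by
    rw [hR₂_def]; exact fromEdgeSet_coe_filter_not_isDiag E₄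
  have hBL : Benv ⊆ L := Set.subset_union_left
  -- (2) the closed cylinder: `c · loc(D) ≤ φ^L_loc(D) ≤ env(D) ≤ φ^Benv_loc(D) ≤ loc(D)`
  have hBpr := rcMeasure_real_free_le_wired_of_radialBound hp hq R₂ EA Core Ann L hCA hW
    (hCoreE R₂ hR₂F) hEA_R₂ hc (F.real_cross_le_of_noCrossBound hp' hq0 hNC hR₂F) hD hDdet
  rw [rcMeasure_congr_graph hGR p q ∅] at hBpr
  have ha1 := rcMeasure_real_wired_le_region_of_isLowerSet (fromEdgeSet (Eenv : Set (Sym2 V))) hp'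
    hq hBL R₂ (hR₂env _) (hoffenv _) hD
  rw [hDR₂] at ha1
  have ha : c * loc.real D ≤ env.real D := hBpr.trans ha1
  have hb : env.real D ≤ loc.real D := by
    have h := rcMeasure_real_le_fromEdgeSet_of_isLowerSet (fromEdgeSet (Eenv : Set (Sym2 V))) hp' hq
      Benv R₂ (hR₂env _) (rcMeasure_real_cylinder_empty_pos _ hp' hp.2 hq0 Benv R₂) hD
    rw [hDR₂] at h
    calc env.real D ≤ _ := h
      _ ≤ (rcMeasure (fromEdgeSet (R₂ : Set (Sym2 V))) p q ∅).real D :=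
          rcMeasure_real_anti_wired_of_isLowerSet _ hp' hq (Set.empty_subset Benv) hD
      _ = loc.real D := by rw [rcMeasure_congr_graph hGR p q ∅]
  -- (3) the increasing part on the graphs with `Sc` deleted: `locI(I) ≤ envI(I) ≤ c⁻¹ locI(I)`
  have hc1 : (rcMeasure (fromEdgeSet (EL : Set (Sym2 V))) p q ∅).real I ≤
      (rcMeasure (fromEdgeSet (EE : Set (Sym2 V))) p q Benv).real I := by
    have h := rcMeasure_fromEdgeSet_real_le (fromEdgeSet (EE : Set (Sym2 V))) hp' hq Benv EL
      (hELEE _) (rcMeasure_real_cylinder_empty_pos _ hp' hp.2 hq0 Benv EL) hI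
    rw [hIEL] at h
    exact (rcMeasure_real_mono_wired_of_isUpperSet _ hp' hq (Set.empty_subset Benv) hI).trans h
  have hApr := rcMeasure_real_wired_le_free_of_radialBound hp hq EL EA Core Ann L hCA hW
    (hCoreE EL hELF) hEA_EL hc (F.real_cross_le_of_noCrossBound hp' hq0 hNC hELF) hI hIdet
  have hd1 := rcMeasure_real_region_le_wired_of_isUpperSet (fromEdgeSet (EE : Set (Sym2 V))) hp'
    hq hBL EL (hELEE _) (hoffEE _) hI
  rw [hIEL] at hd1
  have hd : c * (rcMeasure (fromEdgeSet (EE : Set (Sym2 V))) p q Benv).real I ≤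
      (rcMeasure (fromEdgeSet (EL : Set (Sym2 V))) p q ∅).real I :=
    (mul_le_mul_of_nonneg_left hd1 hc.le).trans hApr
  -- (1)+(4) factorise at the closed cylinder and multiply
  have hfl : loc.real Fd = loc.real D * (rcMeasure (fromEdgeSet (EL : Set (Sym2 V))) p q ∅).real I :=
    rcMeasure_real_eq_mul_of_closed_inter hp' hq0 E₄ Sc T EL ∅ hEL_mem hTEL P (hAE E₄ hE₄F)
  have hfe : env.real Fd =
      env.real D * (rcMeasure (fromEdgeSet (EE : Set (Sym2 V))) p q Benv).real I :=
    rcMeasure_real_eq_mul_of_closed_inter hp' hq0 Eenv Sc T EE Benv hEE_mem hTEE P (hAE Eenv hEenvE)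
  constructor
  · calc c * loc.real Fd
        = c * loc.real D * (rcMeasure (fromEdgeSet (EL : Set (Sym2 V))) p q ∅).real I := by
          rw [hfl]; ring
      _ ≤ env.real D * (rcMeasure (fromEdgeSet (EE : Set (Sym2 V))) p q Benv).real I :=
          mul_le_mul ha hc1 measureReal_nonneg measureReal_nonneg
      _ = env.real Fd := hfe.symm
  · calc c * env.real Fd
        = env.real D * (c * (rcMeasure (fromEdgeSet (EE : Set (Sym2 V))) p q Benv).real I) := by
          rw [hfe]; ring
      _ ≤ loc.real D * (rcMeasure (fromEdgeSet (EL : Set (Sym2 V))) p q ∅).real I :=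
          mul_le_mul hb hd (mul_nonneg hc.le measureReal_nonneg) measureReal_nonneg
      _ = loc.real Fd := hfl.symm

/-- **(K1), registered short name** of `ScaleFrame.datum_prob_comparable` (statement verbatim as
registered on the crux item). [cite: Kesten1986, proof of Lemma (23)] -/
theorem datum_prob_comparable : ∀ {V : Type*} [Fintype V] [DecidableEq V] (F : ScaleFrame V) {p q c a M : ℝ} {m : ℕ}, p ∈ Set.Ico (0 : ℝ) 1 → 1 ≤ q → 0 < c → 0 < a → 2 ≤ M → 1 ≤ m → a * M ^ (m + 4) ≤ F.Rmax → F.η ≤ a → F.NoCrossBound p q c (a * M ^ (m + 2)) (a * M ^ (m + 3)) → ∀ (U' R' : Set V), (∀ v ∈ U', v ∈ F.good ∧ F.rad v < a * M ^ m) → (∀ v ∈ R', v ∈ F.good ∧ F.rad v < a * M ^ m + F.η) → ∀ (Eenv : Finset (Sym2 V)) (Benv : Set V), F.edgesWithin (F.good ∩ {v | F.rad v < a * M ^ (m + 4)}) ⊆ Eenv → Eenv ⊆ F.E → (∀ v ∈ Benv, v ∈ F.good → a * M ^ (m + 4) ≤ F.rad v) → let Fd : Set (Literature.Probability.Percolation.BondConfig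 V) := {ω | ω ∩ (↑F.E : Set (Sym2 V)) ∈ Literature.Probability.Percolation.explEvent (F.inSet a) (F.annSet a (a * M ^ m)) U' R' ∩ {ω | ∀ r ∈ R', ∀ r₂ ∈ R', ∃ v ∈ U', ∃ v' ∈ U', s(v, r) ∈ ω ∧ s(v', r₂) ∈ ω ∧ ω ∈ Literature.Probability.Percolation.openConnIn U' v v'}}; let loc := Literature.Probability.LatticeModels.rcMeasure (SimpleGraph.fromEdgeSet (↑(F.edgesWithin (F.good ∩ {v | F.rad v < a * M ^ (m + 4)})) : Set (Sym2 V))) p q ∅; let env := Literature.Probability.LatticeModels.rcMeasure (SimpleGraph.fromEdgeSet (↑Eenv : Set (Sym2 V))) p q Benv; c * loc.real Fd ≤ env.real Fd ∧ c * env.real Fd ≤ loc.real Fd :=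
  ScaleFrame.datum_prob_comparable

end Literature.Probability.LatticeModels

end
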